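/-
Origin: expansion seat `planner-pub-hodgecm-pv05-g3-0`, handover #3 2026-08-18T05:46:55Z (`HOME/pub-hodgecm-pv05-g3/lean/Pv05g3/FockLowestWeight.lean`, md5 184902ca, 202 lines);
landed by the gen-6 packager in gate run 23 as `HodgeCM/PerL34/FockLowestWeight.lean` (import ^import Pv[0-9]+g[0-9]+\.→import HodgeCM.PerL34. ×1).
-/
/-
Origin: HOME/pub-hodgecm-pv05-g3/lean/Pv05g3/FockLowestWeight.lean — session planner-pub-hodgecm-pv05-g3-0 (unit
pub-hodgecm-pv05-g3, DAG-node prover #05 gen 3).  Intended final place: `HodgeCM/PerL34/FockLowestWeight.lean`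
(namespace `HodgeCM.PerL34.Fock`).  Imports this seat's `FockGL3` (PACKAGER: rewrite `import Pv05g3.FockGL3` to
`import HodgeCM.PerL34.FockGL3`) only; asserts nothing.
-/
import Summits.HodgeConjecture.HodgeCM.PerL34.FockGL3

set_option autoImplicit false

/-!
# Lowest weights, centre and Casimir of the `𝔤𝔩₃(ℂ)`-modules `F_k ⊂ ℂ[z₁, z₂, w]`

Continuation of `FockGL3` (the oscillator representation `oscRep : 𝔤𝔩₃(ℂ) → End ℂ[z₁,z₂,w]`, each `F_k = hpiece k`
an irreducible `𝔤𝔩₃(ℂ)`-submodule).  KERNEL facts, complete proofs, no hypotheses — they pin down the ISOMORPHISM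
CLASS of the `𝔤𝔩₃(ℂ)`-module `F_k` by standard highest/lowest-weight theory:

* `osc_lower_zpow k` / `osc_diag_zpow k` (`k : ℕ`): `z₂^k ∈ F_k` is killed by the three lowering operators
  `E₂₁, E₃₁, E₃₂` (`osc (inl 1) (inl 0)`, `osc (inr ()) (inl 0)`, `osc (inr ()) (inl 1)`) and has weight
  `(E₁₁, E₂₂, E₃₃) ↦ (1, k+1, 0)`; `hpiece_isGeneratedBy_zpow`: `F_k = U(𝔤𝔩₃) · z₂^k`;
* `osc_lower_wpow m` / `osc_diag_wpow m` (`m : ℕ`): `w^m ∈ F_{−m}` is a lowest weight vector of weight `(1, 1, −m)`;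
  `hpiece_isGeneratedBy_wpow`: `F_{−m} = U(𝔤𝔩₃) · w^m`;
* `oscZ = Σ_i osc_ii = oscRep 1` (`oscRep_one`), `oscZ_apply : Z = weightOp uWt + 2`, `oscZ_apply_of_mem`: the centre
  acts on `F_k` by `k + 2`;
* `oscCasimir = Σ_{ij} osc_ij osc_ji`, **`oscCasimir_eq : Ω = Z² − 2Z`** (an identity of differential operators on all
  of `ℂ[z₁,z₂,w]`: in this dual pair the Casimir of `𝔤𝔩₃` is a polynomial in the image of the centre), hence
  `oscCasimir_apply_of_mem`: `Ω` acts on `F_k` by `k² + 2k = (k+1)² − 1`.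

STANDARD CONSEQUENCES (orientation, not typed — the package has no Verma-module / infinitesimal-character vocabulary):
with `hpiece_le_of_oscRep_stable` (irreducibility) the first two items say that `F_k` is THE irreducible lowest
weight `𝔤𝔩₃(ℂ)`-module of lowest weight `μ_k = (1, k+1, 0)` (`k ≥ 0`) resp. `(1, 1, k)` (`k ≤ 0`) for the positive
system `{E₁₂, E₁₃, E₂₃}`, in the integral normalisation of `FockGL3` (genuine normalisation: subtract `½` from every
entry, e.g. `μ_k = (½, k+½, −½)` for `k ≥ 0` — the `K̃′`-labels `(k+½, ½) ⊗ (−½)` of `FockIrreducible`); its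
Harish-Chandra parameter is the `S₃`-orbit of `μ_k − ρ`, `ρ = (1, 0, −1)`, consistent with `Ω ↦ ⟨μ_k, μ_k − 2ρ⟩ =
k² + 2k`; `μ_k − ρ` is a central translate of a regular `ρ`-orbit (the infinitesimal character of a one-dimensional
representation) exactly for `k ∈ {1, −2}`.  This is the algebraic datum against which DICTIONARY item (ii) of GAPS
`pv05g3-K1` (`F_1 ≅ J_{1,0}`, BW VI 4.11 / VIII 2.14, KV78 III (7.2)) is to be compared; the comparison itself is
PRINT and is not made here.

PACKAGER: rewrite `import Pv05g3.FockGL3` ↦ `import HodgeCM.PerL34.FockGL3`; same file-local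
`attribute [local instance 100] LieRing.ofAssociativeRing` as `FockGL3`.
-/

namespace HodgeCM

namespace PerL34

namespace Fock

open MvPolynomial Finsupp

open scoped BigOperators

attribute [local instance 100] LieRing.ofAssociativeRing

section LowestWeight

/-! ## 1. The diagonal (Cartan) operators on monomials -/

/-- `E_{aa} = z_a ∂_{z_a}` is diagonal on monomials. -/
theorem hE_diag_monomial (a : Fin 2) (m : HarmVar →₀ ℕ) (c : ℂ) :
    hE a a (monomial m c) = ((m (Sum.inl a) : ℕ) : ℂ) • monomial m c := by
  rw [hE_monomial]
  by_cases h : m (Sum.inl a) = 0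
  · rw [h, Nat.cast_zero, zero_smul, zero_smul]
  · rw [add_comm (single _ 1), tsub_add_cancel_of_le (single_le_iff.mpr (Nat.one_le_iff_ne_zero.mpr h))]

/-- (Ported verbatim from the HodgeCMPerL package; no docstring in the source.) -/
theorem osc_inl_diag_hmon (i : Fin 2) (a b e : ℕ) :
    osc (Sum.inl i) (Sum.inl i) (hmon a b e) = ((hexp a b e (Sum.inl i) : ℕ) + 1 : ℂ) • hmon a b e := by
  change hE i i (hmon a b e) + (if i = i then (1 : Module.End ℂ HarmModel) else 0) (hmon a b e) = _
  rw [if_pos rfl, Module.End.one_apply, hmon, hE_diag_monomial, add_smul, one_smul]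

/-- (Ported verbatim from the HodgeCMPerL package; no docstring in the source.) -/
theorem osc_inr_diag_hmon (a b e : ℕ) :
    osc (Sum.inr ()) (Sum.inr ()) (hmon a b e) = (-(e : ℂ)) • hmon a b e := by
  change (-hH) (hmon a b e) = _
  rw [LinearMap.neg_apply, hmon, hH_monomial, hexp_inr, neg_smul]

/-! ## 2. Lowest weight vectors

For the positive system `{E₁₂, E₁₃, E₂₃}` of `𝔤𝔩₃` (indices `1, 2 = z₁, z₂`, `3 = w`), a LOWEST weight vector is
one killed by `E₂₁, E₃₁, E₃₂`, i.e. by `osc (inl 1) (inl 0)`, `osc (inr ()) (inl 0)`, `osc (inr ()) (inl 1)`. -/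

/-- The three lowering operators kill `z₂^k = hmon 0 k 0` … -/
theorem osc_lower_zpow (k : ℕ) :
    osc (Sum.inl 1) (Sum.inl 0) (hmon 0 k 0) = 0 ∧ osc (Sum.inr ()) (Sum.inl 0) (hmon 0 k 0) = 0 ∧
      osc (Sum.inr ()) (Sum.inl 1) (hmon 0 k 0) = 0 := by
  refine ⟨?_, ?_, ?_⟩
  · change hE 1 0 (hmon 0 k 0) + (if (1 : Fin 2) = 0 then (1 : Module.End ℂ HarmModel) else 0) (hmon 0 k 0) = 0
    rw [if_neg (by decide), LinearMap.zero_apply, add_zero, hmon, hE_monomial, hexp_inl_zero, Nat.cast_zero,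
      zero_smul]
  · change (-hQ 0) (hmon 0 k 0) = 0
    rw [LinearMap.neg_apply, neg_eq_zero, hmon, hQ_monomial, hexp_inl_zero, zero_mul, Nat.cast_zero, zero_smul]
  · change (-hQ 1) (hmon 0 k 0) = 0
    rw [LinearMap.neg_apply, neg_eq_zero, hmon, hQ_monomial, hexp_inr, mul_zero, Nat.cast_zero, zero_smul]

/-- … and `w^m = hmon 0 0 m`. -/
theorem osc_lower_wpow (m : ℕ) :
    osc (Sum.inl 1) (Sum.inl 0) (hmon 0 0 m) = 0 ∧ osc (Sum.inr ()) (Sum.inl 0) (hmon 0 0 m) = 0 ∧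
      osc (Sum.inr ()) (Sum.inl 1) (hmon 0 0 m) = 0 := by
  refine ⟨?_, ?_, ?_⟩
  · change hE 1 0 (hmon 0 0 m) + (if (1 : Fin 2) = 0 then (1 : Module.End ℂ HarmModel) else 0) (hmon 0 0 m) = 0
    rw [if_neg (by decide), LinearMap.zero_apply, add_zero, hmon, hE_monomial, hexp_inl_zero, Nat.cast_zero,
      zero_smul]
  · change (-hQ 0) (hmon 0 0 m) = 0
    rw [LinearMap.neg_apply, neg_eq_zero, hmon, hQ_monomial, hexp_inl_zero, zero_mul, Nat.cast_zero, zero_smul]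
  · change (-hQ 1) (hmon 0 0 m) = 0
    rw [LinearMap.neg_apply, neg_eq_zero, hmon, hQ_monomial, hexp_inl_one, zero_mul, Nat.cast_zero, zero_smul]

/-- The weight of `z₂^k`: `(E₁₁, E₂₂, E₃₃) ↦ (1, k + 1, 0)`. -/
theorem osc_diag_zpow (k : ℕ) :
    osc (Sum.inl 0) (Sum.inl 0) (hmon 0 k 0) = hmon 0 k 0 ∧
      osc (Sum.inl 1) (Sum.inl 1) (hmon 0 k 0) = ((k : ℂ) + 1) • hmon 0 k 0 ∧
      osc (Sum.inr ()) (Sum.inr ()) (hmon 0 k 0) = 0 := by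
  refine ⟨?_, ?_, ?_⟩
  · rw [osc_inl_diag_hmon, hexp_inl_zero, Nat.cast_zero, zero_add, one_smul]
  · rw [osc_inl_diag_hmon, hexp_inl_one]
  · rw [osc_inr_diag_hmon, Nat.cast_zero, neg_zero, zero_smul]

/-- The weight of `w^m`: `(E₁₁, E₂₂, E₃₃) ↦ (1, 1, −m)`. -/
theorem osc_diag_wpow (m : ℕ) :
    osc (Sum.inl 0) (Sum.inl 0) (hmon 0 0 m) = hmon 0 0 m ∧
      osc (Sum.inl 1) (Sum.inl 1) (hmon 0 0 m) = hmon 0 0 m ∧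
      osc (Sum.inr ()) (Sum.inr ()) (hmon 0 0 m) = (-(m : ℂ)) • hmon 0 0 m := by
  refine ⟨?_, ?_, ?_⟩
  · rw [osc_inl_diag_hmon, hexp_inl_zero, Nat.cast_zero, zero_add, one_smul]
  · rw [osc_inl_diag_hmon, hexp_inl_one, Nat.cast_zero, zero_add, one_smul]
  · rw [osc_inr_diag_hmon]

/-- (Ported verbatim from the HodgeCMPerL package; no docstring in the source.) -/
theorem zpow_mem_hpiece (k : ℕ) : hmon 0 k 0 ∈ hpiece (k : ℤ) := by
  simpa using hmon_mem_hpiece 0 k 0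

/-- (Ported verbatim from the HodgeCMPerL package; no docstring in the source.) -/
theorem wpow_mem_hpiece (m : ℕ) : hmon 0 0 m ∈ hpiece (-(m : ℤ)) := by
  simpa using hmon_mem_hpiece 0 0 m

/-- **`F_k` (`k ≥ 0`) is generated under `oscRep (𝔤𝔩₃)` by the lowest weight vector `z₂^k` of weight `(1, k+1, 0)`**
(with `osc_lower_zpow`, `osc_diag_zpow` and irreducibility `hpiece_le_of_oscRep_stable`: `F_k` is the irreducible
lowest weight `𝔤𝔩₃(ℂ)`-module of lowest weight `(1, k+1, 0)` in the integral normalisation). -/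
theorem hpiece_isGeneratedBy_zpow (k : ℕ) :
    IsGeneratedBy (fun A : Matrix HarmVar HarmVar ℂ => (oscRep A : Module.End ℂ HarmModel).restrict
      (oscRep_mem_hpiece (k : ℤ) A)) (⟨hmon 0 k 0, zpow_mem_hpiece k⟩ : ↥(hpiece (k : ℤ))) :=
  hpiece_isGeneratedBy_oscRep (k : ℤ) (zpow_mem_hpiece k) (hmon_ne_zero 0 k 0)

/-- **`F_{−m}` (`m ≥ 0`) is generated under `oscRep (𝔤𝔩₃)` by the lowest weight vector `w^m` of weight `(1, 1, −m)`.** -/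
theorem hpiece_isGeneratedBy_wpow (m : ℕ) :
    IsGeneratedBy (fun A : Matrix HarmVar HarmVar ℂ => (oscRep A : Module.End ℂ HarmModel).restrict
      (oscRep_mem_hpiece (-(m : ℤ)) A)) (⟨hmon 0 0 m, wpow_mem_hpiece m⟩ : ↥(hpiece (-(m : ℤ)))) :=
  hpiece_isGeneratedBy_oscRep (-(m : ℤ)) (wpow_mem_hpiece m) (hmon_ne_zero 0 0 m)

/-! ## 3. The centre: `Z = oscRep 1 = Σ_i osc_ii` acts on `F_k` by `k + 2` -/

/-- the image of the identity matrix -/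
noncomputable def oscZ : Module.End ℂ HarmModel := ∑ i, osc i i

/-- (Ported verbatim from the HodgeCMPerL package; no docstring in the source.) -/
theorem oscRep_one : oscRep (1 : Matrix HarmVar HarmVar ℂ) = oscZ := by
  rw [oscRep_apply, oscZ]
  refine Finset.sum_congr rfl fun i _ => ?_
  rw [Finset.sum_eq_single i]
  · rw [Matrix.one_apply_eq, one_smul]
  · intro j _ hji
    rw [Matrix.one_apply_ne (Ne.symm hji), zero_smul]
  · intro h; exact absurd (Finset.mem_univ i) h

/-- (Ported verbatim from the HodgeCMPerL package; no docstring in the source.) -/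
theorem oscZ_apply (f : HarmModel) : oscZ f = weightOp uWt f + (2 : ℂ) • f := by
  simp only [oscZ, weightOp_apply, Fintype.sum_sum_type, Fin.sum_univ_two, Fintype.sum_unique,
    LinearMap.add_apply, uWt, Int.cast_one, Int.cast_neg, one_smul, neg_smul, two_smul]
  simp [osc, hE_apply, hH_apply]
  ring

/-- `Z` acts on `F_k` by the scalar `k + 2`. -/
theorem oscZ_apply_of_mem {k : ℤ} {f : HarmModel} (hf : f ∈ hpiece k) : oscZ f = ((k : ℂ) + 2) • f := by
  rw [oscZ_apply, (mem_wpiece_iff uWt k f).mp hf, add_smul]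

/-! ## 4. The Casimir `Ω = Σ_{ij} osc_ij osc_ji = Z² − 2Z` acts on `F_k` by `k² + 2k = (k+1)² − 1` -/

/-- the (quadratic) Casimir of `𝔤𝔩₃` in the representation `oscRep` -/
noncomputable def oscCasimir : Module.End ℂ HarmModel := ∑ i, ∑ j, osc i j * osc j i

/-- **`Ω = Z² − 2Z`**: in the oscillator representation of the pair `(U(1), U(2,1))` the Casimir of `𝔤𝔩₃` is a
polynomial in the image `Z` of the centre (kernel-checked Weyl-algebra identity). -/
theorem oscCasimir_eq : oscCasimir = oscZ * oscZ - (2 : ℂ) • oscZ := by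
  apply LinearMap.ext
  intro f
  simp only [oscCasimir, oscZ, Fintype.sum_sum_type, Fin.sum_univ_two, Fintype.sum_unique, LinearMap.sub_apply,
    LinearMap.add_apply, Module.End.mul_apply, map_add, two_smul]
  simp [osc, hE_apply, hH_apply, hP_apply, hQ_apply, hz, hw]
  ring

/-- `Ω` acts on `F_k` by `k² + 2k`. -/
theorem oscCasimir_apply_of_mem {k : ℤ} {f : HarmModel} (hf : f ∈ hpiece k) :
    oscCasimir f = ((k : ℂ) ^ 2 + 2 * k) • f := by
  rw [oscCasimir_eq, LinearMap.sub_apply, LinearMap.smul_apply, Module.End.mul_apply, oscZ_apply_of_mem hf,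
    map_smul, oscZ_apply_of_mem hf, smul_smul, smul_smul, ← sub_smul]
  congr 1
  ring

end LowestWeight

end Fock

end PerL34

end HodgeCM
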